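import Literature.Barriers.AtomisticToContinuum.HardDiskLemma5Tail
import Literature.Barriers.AtomisticToContinuum.HardDiskLemma5Covariance
import HarnessLib

/-!
# Proof of Richthammer's Lemma 5 for hard discs (Richthammer 2007, §3.5 Lemma 5, §4.3)

Discharge of the named fact `Richthammer2007_lemma5` of `HardDiskTranslationInvarianceSteps.lean`:
if `μ(D + τ̂) + μ(D - τ̂) ≥ μ(D)` for all cylinder events `D ∈ 𝓕_{𝒳,Λ_m}`, `m ∈ ℕ`, and all Gibbs
measures `μ ∈ 𝒢_𝒳(U_hc, z)`, then every Gibbs measure is `τ̂`-invariant.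

## The printed proof and the proof given here

Richthammer [§4.3] proves Lemma 5 "exactly as Proposition (9.1) in [G]": `(𝒳, 𝓕_𝒳)` is
standard Borel, so every Gibbs measure is a mixture of extremal ones (Georgii Thm 7.26) and one
may take `μ` extremal; if `μ ∘ g_τ̂⁻¹ ≠ μ` then `μ`, `μ ∘ g_τ̂⁻¹`, `μ ∘ g_τ̂` are pairwise distinct
extremal Gibbs measures, hence mutually singular on the tail σ-algebra (Georgii Thm 7.7), which
produces a tail event `A` with `μ ∘ g_τ̂(A) + μ ∘ g_τ̂⁻¹(A) = 0 < 1 = μ(A)`, contradicting the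
hypothesis extended from the cylinder algebra to `𝓕_𝒳` by the monotone class theorem.

The Lean proof keeps the two elementary ingredients (covariance `μ ∘ g⁻¹ ∈ 𝒢`, extension of the
inequality to all of `𝓕_𝒳`, `HardDiskLemma5Covariance.lean`, `HardDiskLemma5Kernel.lean`) and replaces the extremal
decomposition by the part of Georgii's Theorem 7.7 that needs no standard-Borel structure, in the
form of Friedli–Velenik's Proposition 6.61 (`HardDiskLemma5Tail.lean`):

1. (`measure_diff_translates_eq_zero`) For every Gibbs `μ` and tail event `T`:
   `μ(T ∖ (g_τ̂⁻¹T ∪ g_{-τ̂}⁻¹T)) = 0`. Indeed `μ(·|T) ∈ 𝒢` (tail conditioning), so the hypothesis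
   applies to it and to the event `A := T ∖ (g_τ̂⁻¹T ∪ g_{-τ̂}⁻¹T)`, both of whose translates miss `T`.
2. (`measure_diff_preimage_translate_eq_zero`) Hence `μ(T ∖ g_{-τ̂}⁻¹T) = 0` for tail `T`: the tail
   event `S := T ∖ g_{-τ̂}⁻¹T` is disjoint from both of its translates, so step 1 gives `μ(S) = 0`.
   By the symmetry `τ̂ ↔ -τ̂` of the hypothesis and passing to complements, `μ(T ∆ g_τ̂⁻¹T) = 0`,
   i.e. `μ ∘ g_τ̂⁻¹ = μ` on `𝓕_{𝒳,∞}`.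
3. `μ ∘ g_τ̂⁻¹ ∈ 𝒢` agrees with `μ` on the tail σ-algebra, so `μ ∘ g_τ̂⁻¹ = μ` by Friedli–Velenik
   Prop. 6.61 (2) (`IsGibbs.ext_of_forall_tail`).

## References

* T. Richthammer, *Translation-invariance of two-dimensional Gibbsian point processes*, Comm.
  Math. Phys. 274 (2007) 81–122, arXiv:0706.3637: §3.5 Lemma 5 and (3.5) (p. 8), §4.3 (p. 10).
* S. Friedli, Y. Velenik, *Statistical Mechanics of Lattice Systems*, CUP 2017, Prop. 6.61,
  Thm 6.58, Lemma 6.62 (§6.8.1).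
* H.-O. Georgii, *Gibbs Measures and Phase Transitions*, de Gruyter 1988/2011, Prop. 9.1,
  Thms 7.7, 7.26 — cited through [Richthammer2007, §4.3].
-/

noncomputable section

open MeasureTheory Set ProbabilityTheory
open scoped ENNReal

namespace Literature.Barriers.AtomisticToContinuum.HardDisk

open Literature.Analysis.FunctionSpaces

/-- **Step 0 (monotone class).** Under the hypothesis of Lemma 5 for the shift `τ`, every Gibbs
measure satisfies `μ(A) ≤ μ(A - τ) + μ(A + τ)` for ALL events `A` (not only cylinder events).
[cite: Richthammer2007, §4.3 (p. 10)] -/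
theorem measure_le_translates_of_cylinder {z : ℝ} {τ : (EuclideanSpace ℝ (Fin 2))}
    (h : ∀ μ : Measure (PointConfig (EuclideanSpace ℝ (Fin 2))), IsGibbs z μ → ∀ m : ℕ, ∀ D : Set (PointConfig (EuclideanSpace ℝ (Fin 2))),
        IsCylinderEvent (box m) D →
          μ D ≤ μ (PointConfig.translate τ ⁻¹' D) + μ (PointConfig.translate (-τ) ⁻¹' D))
    {μ : Measure (PointConfig (EuclideanSpace ℝ (Fin 2)))} (hμ : IsGibbs z μ) {A : Set (PointConfig (EuclideanSpace ℝ (Fin 2)))} (hA : MeasurableSet A) :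
    μ A ≤ μ (PointConfig.translate τ ⁻¹' A) + μ (PointConfig.translate (-τ) ⁻¹' A) := by
  haveI := hμ.1
  have hcyl : ∀ (m : ℕ) (D : Set (PointConfig (EuclideanSpace ℝ (Fin 2)))), IsCylinderEvent (box m) D →
      μ D ≤ (μ.map (PointConfig.translate τ) + μ.map (PointConfig.translate (-τ))) D := by
    intro m D hm
    have hDm : MeasurableSet D := hm.measurableSet (measurableSet_box _)
    rw [Measure.add_apply, Measure.map_apply (PointConfig.measurable_translate _) hDm,
      Measure.map_apply (PointConfig.measurable_translate _) hDm]
    exact h μ hμ m D hm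
  have key := measure_le_of_forall_cylinderEvents hcyl hA
  rwa [Measure.add_apply, Measure.map_apply (PointConfig.measurable_translate _) hA,
    Measure.map_apply (PointConfig.measurable_translate _) hA] at key

/-- **Step 1.** Under the hypothesis of Lemma 5 for `τ`, for every Gibbs measure `μ` and every
tail event `T`, the part of `T` that leaves `T` under both shifts `±τ` is `μ`-null:
`μ(T ∖ (g_τ⁻¹T ∪ g_{-τ}⁻¹T)) = 0` — apply Step 0 to the conditioned Gibbs measure `μ(·|T)` and
the event `T ∖ (g_τ⁻¹T ∪ g_{-τ}⁻¹T)`, whose two translates are disjoint from `T`.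
[cite: Richthammer2007, §4.3 (p. 10)] -/
theorem measure_diff_translates_eq_zero {z : ℝ} {τ : (EuclideanSpace ℝ (Fin 2))}
    (h : ∀ μ : Measure (PointConfig (EuclideanSpace ℝ (Fin 2))), IsGibbs z μ → ∀ m : ℕ, ∀ D : Set (PointConfig (EuclideanSpace ℝ (Fin 2))),
        IsCylinderEvent (box m) D →
          μ D ≤ μ (PointConfig.translate τ ⁻¹' D) + μ (PointConfig.translate (-τ) ⁻¹' D))
    {μ : Measure (PointConfig (EuclideanSpace ℝ (Fin 2)))} (hμ : IsGibbs z μ) {T : Set (PointConfig (EuclideanSpace ℝ (Fin 2)))}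
    (hT : ∀ m : ℕ, IsCylinderEvent (box (m : ℝ))ᶜ T) :
    μ (T \ (PointConfig.translate τ ⁻¹' T ∪ PointConfig.translate (-τ) ⁻¹' T)) = 0 := by
  haveI := hμ.1
  have hTm : MeasurableSet T := measurableSet_of_forall_isCylinderEvent_compl_box hT
  have hAm : MeasurableSet (T \ (PointConfig.translate τ ⁻¹' T ∪ PointConfig.translate (-τ) ⁻¹' T)) :=
    hTm.diff ((hTm.preimage (PointConfig.measurable_translate _)).union
      (hTm.preimage (PointConfig.measurable_translate _)))
  -- the two translates of `A := T \ (g_τ⁻¹ T ∪ g_{-τ}⁻¹ T)` miss `T`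
  have h1 : PointConfig.translate τ ⁻¹' (T \ (PointConfig.translate τ ⁻¹' T ∪
      PointConfig.translate (-τ) ⁻¹' T)) ∩ T = ∅ := by
    refine Set.eq_empty_of_forall_notMem fun Y hY => hY.1.2 (Or.inr ?_)
    show ((Y.translate τ).translate (-τ)) ∈ T
    rw [translate_translate_neg]
    exact hY.2
  have h2 : PointConfig.translate (-τ) ⁻¹' (T \ (PointConfig.translate τ ⁻¹' T ∪
      PointConfig.translate (-τ) ⁻¹' T)) ∩ T = ∅ := by
    refine Set.eq_empty_of_forall_notMem fun Y hY => hY.1.2 (Or.inl ?_)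
    show ((Y.translate (-τ)).translate τ) ∈ T
    rw [translate_neg_translate]
    exact hY.2
  by_cases h0 : μ T = 0
  · exact measure_mono_null sdiff_subset h0
  · have key := measure_le_translates_of_cylinder h (hμ.cond_tail hT h0) hAm
    simp only [Measure.smul_apply, smul_eq_mul] at key
    rw [Measure.restrict_apply hAm, Measure.restrict_apply (hAm.preimage (PointConfig.measurable_translate _)),
      Measure.restrict_apply (hAm.preimage (PointConfig.measurable_translate _)), h1, h2, measure_empty,
      mul_zero, add_zero, inter_eq_left.2 sdiff_subset] at key
    rcases mul_eq_zero.1 (le_antisymm key bot_le) with h' | h'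
    · exact absurd h' (ENNReal.inv_ne_zero.2 (measure_ne_top μ T))
    · exact h'

/-- **Step 2.** Under the hypothesis of Lemma 5 for `τ`, for every Gibbs measure `μ` and every
tail event `T`: `μ(T ∖ g_{-τ}⁻¹T) = 0` — the tail event `S := T ∖ g_{-τ}⁻¹T` is disjoint from
`g_τ⁻¹S` and from `g_{-τ}⁻¹S`, so Step 1 gives `μ(S) = 0`. [cite: Richthammer2007, §4.3 (p. 10)] -/
theorem measure_diff_preimage_translate_eq_zero {z : ℝ} {τ : (EuclideanSpace ℝ (Fin 2))}
    (h : ∀ μ : Measure (PointConfig (EuclideanSpace ℝ (Fin 2))), IsGibbs z μ → ∀ m : ℕ, ∀ D : Set (PointConfig (EuclideanSpace ℝ (Fin 2))),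
        IsCylinderEvent (box m) D →
          μ D ≤ μ (PointConfig.translate τ ⁻¹' D) + μ (PointConfig.translate (-τ) ⁻¹' D))
    {μ : Measure (PointConfig (EuclideanSpace ℝ (Fin 2)))} (hμ : IsGibbs z μ) {T : Set (PointConfig (EuclideanSpace ℝ (Fin 2)))}
    (hT : ∀ m : ℕ, IsCylinderEvent (box (m : ℝ))ᶜ T) :
    μ (T \ PointConfig.translate (-τ) ⁻¹' T) = 0 := by
  have hSt : ∀ m : ℕ, IsCylinderEvent (box (m : ℝ))ᶜ (T \ PointConfig.translate (-τ) ⁻¹' T) :=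
    fun m => MeasurableSet.diff (m := MeasurableSpace.comap _ _) (hT m)
      (forall_isCylinderEvent_compl_box_preimage_translate (-τ) hT m)
  have key := measure_diff_translates_eq_zero h hμ hSt
  have hSS : (T \ PointConfig.translate (-τ) ⁻¹' T) \
      (PointConfig.translate τ ⁻¹' (T \ PointConfig.translate (-τ) ⁻¹' T) ∪
        PointConfig.translate (-τ) ⁻¹' (T \ PointConfig.translate (-τ) ⁻¹' T)) =
      T \ PointConfig.translate (-τ) ⁻¹' T := by
    refine Set.ext fun Y => ⟨fun hY => hY.1, fun hY => ⟨hY, ?_⟩⟩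
    rintro (hY' | hY')
    · refine hY'.2 ?_
      show ((Y.translate τ).translate (-τ)) ∈ T
      rw [translate_translate_neg]
      exact hY.1
    · exact hY.2 hY'.1
  rwa [hSS] at key

/-- **Richthammer 2007, Lemma 5, for the hard-disc model — proved.** If
`μ(D + τ̂) + μ(D - τ̂) ≥ μ(D)` for all cylinder events `D ∈ 𝓕_{𝒳,Λ_m}`, `m ∈ ℕ`, and all Gibbs
measures `μ ∈ 𝒢_𝒳(U_hc, z)`, then every Gibbs measure is `τ̂`-invariant. Proof: `μ ∘ g_τ̂⁻¹` is a
Gibbs measure (`IsGibbs.map_translate`) which agrees with `μ` on the tail σ-algebra by Step 2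
applied to `±τ̂` and to `T`, `Tᶜ`; two Gibbs measures agreeing on `𝓕_{𝒳,∞}` are equal
(`IsGibbs.ext_of_forall_tail`, Friedli–Velenik Prop. 6.61 (2) / Georgii Thm 7.7). This
replaces the extremal decomposition of the printed proof (§4.3, Georgii Prop. 9.1 and Thm 7.26).
[cite: Richthammer2007, §3.5 Lemma 5 (p. 8) and §4.3 (p. 10)] -/
theorem Richthammer2007_lemma5_holds : Richthammer2007_lemma5 := by
  intro z _ τ h μ hμ
  haveI := hμ.1
  -- the hypothesis is symmetric under `τ ↦ -τ`
  have h' : ∀ ν : Measure (PointConfig (EuclideanSpace ℝ (Fin 2))), IsGibbs z ν → ∀ m : ℕ, ∀ D : Set (PointConfig (EuclideanSpace ℝ (Fin 2))),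
      IsCylinderEvent (box m) D →
        ν D ≤ ν (PointConfig.translate (-τ) ⁻¹' D) + ν (PointConfig.translate (-(-τ)) ⁻¹' D) := by
    intro ν hν m D hD
    rw [neg_neg, add_comm]
    exact h ν hν m D hD
  refine (hμ.map_translate τ).ext_of_forall_tail hμ fun T hT => ?_
  have hTm : MeasurableSet T := measurableSet_of_forall_isCylinderEvent_compl_box hT
  rw [Measure.map_apply (PointConfig.measurable_translate τ) hTm]
  -- `μ (T \ g_τ⁻¹ T) = 0` and `μ (g_τ⁻¹ T \ T) = 0`
  have h1 : μ (T \ PointConfig.translate τ ⁻¹' T) = 0 := by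
    have key := measure_diff_preimage_translate_eq_zero h' hμ hT
    rwa [neg_neg] at key
  have h2 : μ (PointConfig.translate τ ⁻¹' T \ T) = 0 := by
    have key := measure_diff_preimage_translate_eq_zero h' hμ
      (fun m => MeasurableSet.compl (m := MeasurableSpace.comap _ _) (hT m))
    rw [neg_neg] at key
    have hset : Tᶜ \ PointConfig.translate τ ⁻¹' Tᶜ = PointConfig.translate τ ⁻¹' T \ T := by
      ext Y
      simp only [mem_sdiff, mem_compl_iff, mem_preimage, not_not]
      tauto
    rwa [hset] at key
  calc μ (PointConfig.translate τ ⁻¹' T)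
      = μ (PointConfig.translate τ ⁻¹' T ∩ T) + μ (PointConfig.translate τ ⁻¹' T \ T) :=
        (measure_inter_add_sdiff _ hTm).symm
    _ = μ (T ∩ PointConfig.translate τ ⁻¹' T) + μ (T \ PointConfig.translate τ ⁻¹' T) := by
        rw [h1, h2, inter_comm]
    _ = μ T := measure_inter_add_sdiff _ (hTm.preimage (PointConfig.measurable_translate τ))

end Literature.Barriers.AtomisticToContinuum.HardDisk

end
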